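import Literature.Probability.RandomPlanarGeometry.NestingTransform
import Literature.Probability.Percolation.FKLoopNestingIntegrable
import Literature.Probability.Percolation.InterfaceLoopWindingSign
import HarnessLib

/-!
# Estimates on the loop phase `∫_{int u} f` and the twisted weight `2cos(∫_{int u} f + π/3)`

Elementary, lattice-free estimates on the two ingredients of the `cos_μ`-twisted nesting transform
(`Literature.Probability.RandomPlanarGeometry.NestingTransform`: `UnbasedLoop.nestingPhase f u =
∫_{W(u,·) ≠ 0} f`, `UnbasedLoop.nestingFactor f u = 2cos(nestingPhase f u + π/3)`) for a density
`f` of the admissible class of the consumer statements (`|f| ≤ C`, `f = 0` off `B̄(0, R)`,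
measurable, `∫ f = 0`) — the inputs that every "restrict to big loops and couple" argument
(Duminil-Copin–Kozlowski–Lammers–Manolescu, arXiv:2603.06268, §5 p. 37) uses loop by loop:

* **locality** — the interior `{W(u,·) ≠ 0}` lies in the closed ball of radius `diam(trace u)`
  about any point of the trace (`UnbasedLoop.setOf_wind_ne_zero_subset_closedBall`), so
  `|∫_{int u} f| ≤ C · Leb(B̄(x, diam u))` (`abs_nestingPhase_le_mul_volume_closedBall`: small loops
  have small phases) and, in general, `|∫_{int u} f| ≤ C · Leb(B̄(0, R))`;
* **support** — a loop whose trace misses `B̄(0, R)` has phase `0` and weight `1`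
  (`nestingPhase_eq_zero_of_disjoint`, `nestingFactor_eq_one_of_disjoint`; the winding number is
  constant on the ball and `∫ f = 0`), the density form of
  `signedMeasure_loopInterior_eq_zero_of_disjoint`;
* **continuity in DKKMO's loop distance** — two loops at unoriented distance `d = udist u v` have
  interiors that differ only inside the closed `d`-collar of the trace of `u`
  (`UnbasedLoop.symmDiff_setOf_wind_ne_zero_subset_cthickening`, from
  `UnbasedLoop.wind_eq_or_eq_neg_of_udist_lt`), hence
  `|∫_{int u} f − ∫_{int v} f| ≤ C · Leb(collar ∩ B̄(0, R))` (`abs_nestingPhase_sub_le`) and the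
  weight is `2`-Lipschitz in the phase (`abs_nestingFactor_sub_le`);
* **products** — `|∏_{i ∈ s} a i − ∏_{i ∈ s} b i| ≤ M^{#s} Σ_{i ∈ s} |a i − b i|` when
  `|a i|, |b i| ≤ M`, `1 ≤ M` (`Finset.abs_prod_sub_prod_le`; with `M = 2 ≥ |cos_μ|`), and the
  resulting comparison of the nesting weights of two `ε`-matched finite loop families
  (`abs_prod_nestingFactor_sub_prod_le`) — the deterministic half of the transfer of a truncated
  nesting transform along a `d_CN`-coupling.

Everything is proved; no definition is introduced.

## References

* H. Duminil-Copin, K. K. Kozlowski, P. Lammers, I. Manolescu, arXiv:2603.06268 (2026), §3.2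
  (`int(ℓ)`, `cos_μ`), §5 p. 37 ("restrict to large loops").
* H. Duminil-Copin, K. K. Kozlowski, D. Krachun, I. Manolescu, M. Oulamara, arXiv:2012.11672v2,
  §1.2 eq. (1) (the loop distance `d`).
* W. Fulton, *Algebraic Topology: A First Course* (1995), §3 (winding numbers).
-/

noncomputable section

open MeasureTheory Set Filter Metric
open scoped Real Topology symmDiff

namespace Literature.Probability.Percolation

open LatticeModels RandomPlanarGeometry

/-! ### Locality: the interior of a loop lies within `diam` of its trace -/

/-- An unbased loop inside a ball not containing `z` does not wind around `z`. Deliberate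
dot-notation extension of `Literature.Probability.RandomPlanarGeometry.UnbasedLoop`. [folklore] -/
theorem _root_.Literature.Probability.RandomPlanarGeometry.UnbasedLoop.wind_eq_zero_of_subset_ball
    (u : UnbasedLoop ℂ) {w z : ℂ} {ρ : ℝ} (hu : u.range ⊆ ball w ρ) (hz : ρ ≤ dist z w) :
    u.wind z = 0 := by
  obtain ⟨ℓ, rfl⟩ := UnbasedLoop.mk_surjective u
  rw [UnbasedLoop.range_mk] at hu
  rw [UnbasedLoop.wind_mk]
  exact ℓ.toCurveClass.wind_eq_zero_of_subset_ball hu hz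

/-- **The interior of a loop lies in the closed ball of radius `diam(trace)` about any point of
the trace**: a point farther than the diameter from a trace point sees the whole trace inside an
open ball missing it, so the loop does not wind around it. Deliberate dot-notation extension of
`Literature.Probability.RandomPlanarGeometry.UnbasedLoop`. [folklore] -/
theorem _root_.Literature.Probability.RandomPlanarGeometry.UnbasedLoop.setOf_wind_ne_zero_subset_closedBall
    (u : UnbasedLoop ℂ) {x : ℂ} (hx : x ∈ u.range) :
    {z | u.wind z ≠ 0} ⊆ closedBall x (diam u.range) := by
  intro z hz
  by_contra hzx
  rw [mem_closedBall, not_le] at hzx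
  refine hz (u.wind_eq_zero_of_subset_ball (w := x) (ρ := dist z x) (fun y hy ↦ ?_) le_rfl)
  exact mem_ball.2 ((dist_le_diam_of_mem u.isCompact_range.isBounded hy hx).trans_lt hzx)

/-- The interior of a loop is a Borel set (it is open, `UnbasedLoop.isOpen_setOf_wind_ne_zero`).
[folklore] -/
theorem measurableSet_setOf_wind_ne_zero (u : UnbasedLoop ℂ) : MeasurableSet {z | u.wind z ≠ 0} :=
  u.isOpen_setOf_wind_ne_zero.measurableSet

section Density

variable {f : ℂ → ℝ} {R C : ℝ}

/-- The bound `|f| ≤ C` forces `0 ≤ C`. [folklore] -/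
theorem nonneg_of_abs_le (hC : ∀ z, |f z| ≤ C) : 0 ≤ C := (abs_nonneg _).trans (hC 0)

/-- **Phases are bounded by `C ×` the volume of the part of the interior carrying `f`**: for
`|f| ≤ C` vanishing off `B̄(0, R)` and any set `A`,
`|∫_A f| ≤ C · Leb(A ∩ B̄(0, R))`. [folklore] -/
theorem abs_setIntegral_le_mul_volume_inter (hC : ∀ z, |f z| ≤ C) (hR : ∀ z, R < ‖z‖ → f z = 0)
    (A : Set ℂ) : |∫ z in A, f z| ≤ C * volume.real (A ∩ closedBall (0 : ℂ) R) := by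
  have hind : f = (closedBall (0 : ℂ) R).indicator f := eq_indicator_closedBall_of_eq_zero hR
  have h1 : ∫ z in A, f z = ∫ z in A ∩ closedBall (0 : ℂ) R, f z := by
    conv_lhs => rw [hind]
    rw [setIntegral_indicator measurableSet_closedBall]
  rw [h1]
  have hfin : volume (A ∩ closedBall (0 : ℂ) R) < ⊤ :=
    (measure_mono Set.inter_subset_right).trans_lt measure_closedBall_lt_top
  calc |∫ z in A ∩ closedBall (0 : ℂ) R, f z|
      = ‖∫ z in A ∩ closedBall (0 : ℂ) R, f z‖ := (Real.norm_eq_abs _).symm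
    _ ≤ C * volume.real (A ∩ closedBall (0 : ℂ) R) := by
        refine norm_setIntegral_le_of_norm_le_const hfin fun z _ ↦ ?_
        rw [Real.norm_eq_abs]
        exact hC z

/-- `|∫_{int u} f| ≤ C · Leb({W(u,·) ≠ 0} ∩ B̄(0, R))`. [folklore] -/
theorem abs_nestingPhase_le (hC : ∀ z, |f z| ≤ C) (hR : ∀ z, R < ‖z‖ → f z = 0)
    (u : UnbasedLoop ℂ) :
    |u.nestingPhase f| ≤ C * volume.real ({z | u.wind z ≠ 0} ∩ closedBall (0 : ℂ) R) :=
  abs_setIntegral_le_mul_volume_inter hC hR _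

/-- **Uniform bound**: `|∫_{int u} f| ≤ C · Leb(B̄(0, R))` for every loop. [folklore] -/
theorem abs_nestingPhase_le_mul_volume_closedBall (hC : ∀ z, |f z| ≤ C)
    (hR : ∀ z, R < ‖z‖ → f z = 0) (u : UnbasedLoop ℂ) :
    |u.nestingPhase f| ≤ C * volume.real (closedBall (0 : ℂ) R) := by
  refine (abs_nestingPhase_le hC hR u).trans (mul_le_mul_of_nonneg_left ?_ (nonneg_of_abs_le hC))
  exact measureReal_mono Set.inter_subset_right measure_closedBall_lt_top.ne

/-- **Small loops have small phases**: `|∫_{int u} f| ≤ C · Leb(B̄(x, diam(trace u)))` for any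
point `x` of the trace (the interior lies in that ball,
`UnbasedLoop.setOf_wind_ne_zero_subset_closedBall`). [folklore] -/
theorem abs_nestingPhase_le_mul_volume_closedBall_diam (hC : ∀ z, |f z| ≤ C)
    (hR : ∀ z, R < ‖z‖ → f z = 0) (u : UnbasedLoop ℂ) {x : ℂ} (hx : x ∈ u.range) :
    |u.nestingPhase f| ≤ C * volume.real (closedBall x (diam u.range)) := by
  refine (abs_nestingPhase_le hC hR u).trans (mul_le_mul_of_nonneg_left ?_ (nonneg_of_abs_le hC))
  exact measureReal_mono (Set.inter_subset_left.trans (u.setOf_wind_ne_zero_subset_closedBall hx))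
    measure_closedBall_lt_top.ne

/-! ### Support: loops missing the ball carrying `f` contribute the factor `1` -/

/-- **A loop whose trace misses `B̄(0, R)` has phase `0`** when `f = 0` off `B̄(0, R)` and
`∫ f = 0`: the winding number is constant on the ball (`UnbasedLoop.wind_eq_wind_of_disjoint`);
if it vanishes there the interior carries no `f`-mass, otherwise the interior contains the ball
and `∫_{int u} f = ∫ f = 0`. [cite: DuminilCopinKozlowskiLammersManolescu2026, §3.2] -/
theorem nestingPhase_eq_zero_of_disjoint (hR : ∀ z, R < ‖z‖ → f z = 0) (h0 : ∫ z, f z = 0)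
    {u : UnbasedLoop ℂ} (hdisj : Disjoint u.range (closedBall (0 : ℂ) R)) :
    u.nestingPhase f = 0 := by
  have hind : f = (closedBall (0 : ℂ) R).indicator f := eq_indicator_closedBall_of_eq_zero hR
  rw [UnbasedLoop.nestingPhase, hind, setIntegral_indicator measurableSet_closedBall]
  by_cases hc : u.wind 0 = 0
  · -- the ball is outside the interior
    have hempty : {z | u.wind z ≠ 0} ∩ closedBall (0 : ℂ) R = ∅ := by
      refine Set.eq_empty_of_forall_notMem fun z ⟨hz, hzB⟩ ↦ hz ?_
      have hR0 : (0 : ℝ) ≤ R := by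
        have := mem_closedBall.1 hzB
        rw [dist_zero_right] at this
        exact (norm_nonneg _).trans this
      rw [u.wind_eq_wind_of_disjoint hdisj hzB (mem_closedBall_self hR0)]
      exact hc
    rw [hempty, Measure.restrict_empty, integral_zero_measure]
  · -- the ball is inside the interior
    have hsub : closedBall (0 : ℂ) R ⊆ {z | u.wind z ≠ 0} := by
      intro z hzB
      have hR0 : (0 : ℝ) ≤ R := by
        have := mem_closedBall.1 hzB
        rw [dist_zero_right] at this
        exact (norm_nonneg _).trans this
      show u.wind z ≠ 0
      rw [u.wind_eq_wind_of_disjoint hdisj hzB (mem_closedBall_self hR0)]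
      exact hc
    rw [Set.inter_eq_right.2 hsub, setIntegral_eq_integral_of_forall_compl_eq_zero fun z hz ↦ ?_]
    · exact h0
    · exact hR z (by simpa [mem_closedBall, dist_zero_right, not_le] using hz)

/-- A loop whose trace misses `B̄(0, R)` has weight `cos_μ(0) = 1`.
[cite: DuminilCopinKozlowskiLammersManolescu2026, §3.2] -/
theorem nestingFactor_eq_one_of_disjoint (hR : ∀ z, R < ‖z‖ → f z = 0) (h0 : ∫ z, f z = 0)
    {u : UnbasedLoop ℂ} (hdisj : Disjoint u.range (closedBall (0 : ℂ) R)) :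
    u.nestingFactor f = 1 :=
  UnbasedLoop.nestingFactor_eq_one_of_nestingPhase_eq_zero (nestingPhase_eq_zero_of_disjoint hR h0 hdisj)

/-- Contributing loops (weight `≠ 1`) meet the closed ball carrying `f`.
[cite: DuminilCopinKozlowskiLammersManolescu2026, §3.2] -/
theorem range_inter_closedBall_nonempty_of_nestingFactor_ne_one (hR : ∀ z, R < ‖z‖ → f z = 0)
    (h0 : ∫ z, f z = 0) {u : UnbasedLoop ℂ} (hu : u.nestingFactor f ≠ 1) :
    (u.range ∩ closedBall (0 : ℂ) R).Nonempty := by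
  by_contra hempty
  rw [Set.not_nonempty_iff_eq_empty] at hempty
  exact hu (nestingFactor_eq_one_of_disjoint hR h0 (Set.disjoint_iff_inter_eq_empty.2 hempty))

end Density

/-! ### Continuity in DKKMO's loop distance `d` -/

/-- **Interiors of `d`-close loops differ only near the trace**: the symmetric difference of
`{W(u,·) ≠ 0}` and `{W(v,·) ≠ 0}` lies in the closed `d(u,v)`-collar `{z | dist(z, trace u) ≤
d(u, v)}` of the trace of `u` — off the collar the two winding numbers agree up to sign
(`UnbasedLoop.wind_eq_or_eq_neg_of_udist_lt`). Deliberate dot-notation extension of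
`Literature.Probability.RandomPlanarGeometry.UnbasedLoop`. [folklore] -/
theorem _root_.Literature.Probability.RandomPlanarGeometry.UnbasedLoop.symmDiff_setOf_wind_ne_zero_subset
    (u v : UnbasedLoop ℂ) :
    {z | u.wind z ≠ 0} ∆ {z | v.wind z ≠ 0} ⊆ {z | infDist z u.range ≤ u.udist v} := by
  intro z hz
  by_contra hfar
  simp only [mem_setOf_eq, not_le] at hfar
  have key : v.wind z ≠ 0 ↔ u.wind z ≠ 0 := by
    rcases UnbasedLoop.wind_eq_or_eq_neg_of_udist_lt hfar with h | h <;> simp [h]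
  rcases hz with ⟨hu, hv⟩ | ⟨hv, hu⟩
  · exact hv (key.2 hu)
  · exact hu (key.1 hv)

/-- The collar `{z | dist(z, trace u) ≤ r}` is closed, hence Borel. [folklore] -/
theorem measurableSet_setOf_infDist_le (u : UnbasedLoop ℂ) (r : ℝ) :
    MeasurableSet {z : ℂ | infDist z u.range ≤ r} :=
  (isClosed_le (continuous_infDist_pt u.range) continuous_const).measurableSet

section DensityContinuity

variable {f : ℂ → ℝ} {R C : ℝ}

/-- **Continuity of the phase in `d`**: for `|f| ≤ C` measurable vanishing off `B̄(0, R)` and two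
loops `u`, `v`,
`|∫_{int u} f − ∫_{int v} f| ≤ C · Leb({dist(·, trace u) ≤ d(u, v)} ∩ B̄(0, R))`.
[folklore] -/
theorem abs_nestingPhase_sub_le (hf : Measurable f) (hC : ∀ z, |f z| ≤ C)
    (hR : ∀ z, R < ‖z‖ → f z = 0) (u v : UnbasedLoop ℂ) :
    |u.nestingPhase f - v.nestingPhase f| ≤
      C * volume.real ({z : ℂ | infDist z u.range ≤ u.udist v} ∩ closedBall (0 : ℂ) R) := by
  have hfi : Integrable f volume := integrable_of_abs_le_of_eq_zero hf hC hR
  set A : Set ℂ := {z | u.wind z ≠ 0} with hA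
  set B : Set ℂ := {z | v.wind z ≠ 0} with hB
  have hAm : MeasurableSet A := measurableSet_setOf_wind_ne_zero u
  have hBm : MeasurableSet B := measurableSet_setOf_wind_ne_zero v
  -- split both integrals along `A ∩ B`
  have hsplitA : ∫ z in A, f z = (∫ z in A ∩ B, f z) + ∫ z in A \ B, f z := by
    rw [← setIntegral_union (Set.disjoint_sdiff_inter.symm) (hAm.diff hBm) hfi.integrableOn
      hfi.integrableOn, Set.inter_union_sdiff]
  have hsplitB : ∫ z in B, f z = (∫ z in A ∩ B, f z) + ∫ z in B \ A, f z := by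
    rw [Set.inter_comm, ← setIntegral_union (Set.disjoint_sdiff_inter.symm) (hBm.diff hAm)
      hfi.integrableOn hfi.integrableOn, Set.inter_union_sdiff]
  have hdiff : u.nestingPhase f - v.nestingPhase f = (∫ z in A \ B, f z) - ∫ z in B \ A, f z := by
    rw [UnbasedLoop.nestingPhase, UnbasedLoop.nestingPhase, ← hA, ← hB, hsplitA, hsplitB]
    ring
  rw [hdiff]
  -- both pieces live in the symmetric difference, inside the collar
  set K : Set ℂ := {z : ℂ | infDist z u.range ≤ u.udist v} with hK
  have hKm : MeasurableSet K := measurableSet_setOf_infDist_le u _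
  have hsd : A ∆ B ⊆ K := u.symmDiff_setOf_wind_ne_zero_subset v
  have h1 : |∫ z in A \ B, f z| ≤ C * volume.real ((A \ B) ∩ closedBall (0 : ℂ) R) :=
    abs_setIntegral_le_mul_volume_inter hC hR _
  have h2 : |∫ z in B \ A, f z| ≤ C * volume.real ((B \ A) ∩ closedBall (0 : ℂ) R) :=
    abs_setIntegral_le_mul_volume_inter hC hR _
  have hC0 : 0 ≤ C := nonneg_of_abs_le hC
  have hfin : volume (K ∩ closedBall (0 : ℂ) R) ≠ ⊤ :=
    ((measure_mono Set.inter_subset_right).trans_lt measure_closedBall_lt_top).ne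
  -- the two pieces are disjoint Borel subsets of `K ∩ B̄`
  have hunion : volume.real ((A \ B) ∩ closedBall (0 : ℂ) R) +
      volume.real ((B \ A) ∩ closedBall (0 : ℂ) R) ≤ volume.real (K ∩ closedBall (0 : ℂ) R) := by
    have hfinA : volume ((A \ B) ∩ closedBall (0 : ℂ) R) ≠ ⊤ :=
      ((measure_mono Set.inter_subset_right).trans_lt measure_closedBall_lt_top).ne
    have hfinB : volume ((B \ A) ∩ closedBall (0 : ℂ) R) ≠ ⊤ :=
      ((measure_mono Set.inter_subset_right).trans_lt measure_closedBall_lt_top).ne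
    rw [← measureReal_union ((disjoint_sdiff_sdiff (x := A) (y := B)).mono Set.inter_subset_left
      Set.inter_subset_left) ((hBm.diff hAm).inter measurableSet_closedBall) hfinA hfinB]
    refine measureReal_mono ?_ hfin
    rintro z (⟨hz, hzB⟩ | ⟨hz, hzB⟩)
    · exact ⟨hsd (Or.inl hz), hzB⟩
    · exact ⟨hsd (Or.inr hz), hzB⟩
  calc |(∫ z in A \ B, f z) - ∫ z in B \ A, f z|
      ≤ |∫ z in A \ B, f z| + |∫ z in B \ A, f z| := abs_sub _ _
    _ ≤ C * volume.real ((A \ B) ∩ closedBall (0 : ℂ) R) +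
          C * volume.real ((B \ A) ∩ closedBall (0 : ℂ) R) := add_le_add h1 h2
    _ = C * (volume.real ((A \ B) ∩ closedBall (0 : ℂ) R) +
          volume.real ((B \ A) ∩ closedBall (0 : ℂ) R)) := by ring
    _ ≤ C * volume.real (K ∩ closedBall (0 : ℂ) R) := mul_le_mul_of_nonneg_left hunion hC0

/-- Monotone form: if `d(u, v) ≤ ε` then
`|∫_{int u} f − ∫_{int v} f| ≤ C · Leb({dist(·, trace u) ≤ ε} ∩ B̄(0, R))`. [folklore] -/
theorem abs_nestingPhase_sub_le_of_udist_le (hf : Measurable f) (hC : ∀ z, |f z| ≤ C)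
    (hR : ∀ z, R < ‖z‖ → f z = 0) {u v : UnbasedLoop ℂ} {ε : ℝ} (hε : u.udist v ≤ ε) :
    |u.nestingPhase f - v.nestingPhase f| ≤
      C * volume.real ({z : ℂ | infDist z u.range ≤ ε} ∩ closedBall (0 : ℂ) R) := by
  refine (abs_nestingPhase_sub_le hf hC hR u v).trans
    (mul_le_mul_of_nonneg_left ?_ (nonneg_of_abs_le hC))
  refine measureReal_mono (fun z hz ↦ ⟨le_trans (α := ℝ) hz.1 hε, hz.2⟩)
    ((measure_mono Set.inter_subset_right).trans_lt measure_closedBall_lt_top).ne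

end DensityContinuity

/-- **The weight is `2`-Lipschitz in the phase**: `|cos_μ(x) − cos_μ(y)| ≤ 2|x − y|` at
`μ = 1/6` (`cos` is `1`-Lipschitz). [folklore] -/
theorem abs_nestingFactor_sub_le (f g : ℂ → ℝ) (u v : UnbasedLoop ℂ) :
    |u.nestingFactor f - v.nestingFactor g| ≤ 2 * |u.nestingPhase f - v.nestingPhase g| := by
  rw [UnbasedLoop.nestingFactor, UnbasedLoop.nestingFactor, ← mul_sub, abs_mul, abs_two]
  refine mul_le_mul_of_nonneg_left ?_ zero_le_two
  refine (Real.abs_cos_sub_cos_le _ _).trans_eq ?_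
  congr 1
  ring

/-! ### Products of bounded factors -/

/-- **Comparison of finite products of bounded factors**: if `|a i|, |b i| ≤ M` on `s` with
`1 ≤ M`, then `|∏_{i ∈ s} a i − ∏_{i ∈ s} b i| ≤ M ^ #s · Σ_{i ∈ s} |a i − b i|` (telescoping).
With `M = 2 ≥ |cos_μ|` this compares the nesting weights of two matched finite loop families.
[folklore] -/
theorem _root_.Finset.abs_prod_sub_prod_le {ι : Type*} [DecidableEq ι] (s : Finset ι)
    {a b : ι → ℝ} {M : ℝ} (hM : 1 ≤ M) (ha : ∀ i ∈ s, |a i| ≤ M) (hb : ∀ i ∈ s, |b i| ≤ M) :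
    |∏ i ∈ s, a i - ∏ i ∈ s, b i| ≤ M ^ s.card * ∑ i ∈ s, |a i - b i| := by
  induction s using Finset.induction_on with
  | empty => simp
  | insert j s hj ih =>
    have ha' : ∀ i ∈ s, |a i| ≤ M := fun i hi ↦ ha i (Finset.mem_insert_of_mem hi)
    have hb' : ∀ i ∈ s, |b i| ≤ M := fun i hi ↦ hb i (Finset.mem_insert_of_mem hi)
    have hM0 : 0 ≤ M := zero_le_one.trans hM
    have hprod : |∏ i ∈ s, a i| ≤ M ^ s.card := by
      rw [Finset.abs_prod]
      calc ∏ i ∈ s, |a i| ≤ ∏ _i ∈ s, M := Finset.prod_le_prod (fun i _ ↦ abs_nonneg _) ha'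
        _ = M ^ s.card := Finset.prod_const M
    have hsum0 : 0 ≤ ∑ i ∈ s, |a i - b i| := Finset.sum_nonneg fun i _ ↦ abs_nonneg _
    rw [Finset.prod_insert hj, Finset.prod_insert hj, Finset.sum_insert hj,
      Finset.card_insert_of_notMem hj, pow_succ]
    have hsplit : a j * ∏ i ∈ s, a i - b j * ∏ i ∈ s, b i =
        (a j - b j) * ∏ i ∈ s, a i + b j * (∏ i ∈ s, a i - ∏ i ∈ s, b i) := by ring
    rw [hsplit]
    calc |(a j - b j) * ∏ i ∈ s, a i + b j * (∏ i ∈ s, a i - ∏ i ∈ s, b i)|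
        ≤ |(a j - b j) * ∏ i ∈ s, a i| + |b j * (∏ i ∈ s, a i - ∏ i ∈ s, b i)| := abs_add_le _ _
      _ = |a j - b j| * |∏ i ∈ s, a i| + |b j| * |∏ i ∈ s, a i - ∏ i ∈ s, b i| := by
          rw [abs_mul, abs_mul]
      _ ≤ |a j - b j| * M ^ s.card + M * (M ^ s.card * ∑ i ∈ s, |a i - b i|) := by
          gcongr
          · exact hb j (Finset.mem_insert_self j s)
          · exact ih ha' hb'
      _ ≤ M ^ s.card * M * (|a j - b j| + ∑ i ∈ s, |a i - b i|) := by
          have h1 : |a j - b j| * M ^ s.card ≤ M ^ s.card * M * |a j - b j| := by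
            rw [mul_comm]
            refine mul_le_mul_of_nonneg_right ?_ (abs_nonneg _)
            exact le_mul_of_one_le_right (pow_nonneg hM0 _) hM
          nlinarith [h1, pow_nonneg hM0 s.card, abs_nonneg (a j - b j)]

/-! ### Nesting weights of `ε`-matched finite loop families -/

section Matching

variable {f : ℂ → ℝ} {R C : ℝ}

/-- **Comparison of the nesting weights of two `ε`-matched finite loop families**: if `σ` sends
every loop `u` of the finite family `s` to a loop with `d(u, σ u) ≤ ε` (DKKMO's unoriented
distance), then
`|∏_{u ∈ s} cos_μ(∫_{int u} f) − ∏_{u ∈ s} cos_μ(∫_{int σu} f)| ≤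
2^{#s} · Σ_{u ∈ s} 2C · Leb({dist(·, trace u) ≤ ε} ∩ B̄(0, R))`
(`Finset.abs_prod_sub_prod_le` with `|cos_μ| ≤ 2`, `abs_nestingFactor_sub_le`,
`abs_nestingPhase_sub_le_of_udist_le`). This is the deterministic, loop-by-loop half of the
transfer of a truncated nesting transform along a `d_CN`-coupling; the probabilistic half is the
control of the collar volumes and of `#s`. [folklore] -/
theorem abs_prod_nestingFactor_sub_prod_le (hf : Measurable f) (hC : ∀ z, |f z| ≤ C)
    (hR : ∀ z, R < ‖z‖ → f z = 0) (s : Finset (UnbasedLoop ℂ)) (σ : UnbasedLoop ℂ → UnbasedLoop ℂ)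
    {ε : ℝ} (hσ : ∀ u ∈ s, u.udist (σ u) ≤ ε) :
    |∏ u ∈ s, u.nestingFactor f - ∏ u ∈ s, (σ u).nestingFactor f| ≤
      2 ^ s.card * ∑ u ∈ s,
        2 * (C * volume.real ({z : ℂ | infDist z u.range ≤ ε} ∩ closedBall (0 : ℂ) R)) := by
  classical
  refine (Finset.abs_prod_sub_prod_le s one_le_two (fun u _ ↦ UnbasedLoop.abs_nestingFactor_le f u)
    (fun u _ ↦ UnbasedLoop.abs_nestingFactor_le f (σ u))).trans ?_
  refine mul_le_mul_of_nonneg_left (Finset.sum_le_sum fun u hu ↦ ?_) (pow_nonneg zero_le_two _)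
  exact (abs_nestingFactor_sub_le f f u (σ u)).trans (mul_le_mul_of_nonneg_left
    (abs_nestingPhase_sub_le_of_udist_le hf hC hR (hσ u hu)) zero_le_two)

end Matching

end Literature.Probability.Percolation

end
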